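import Summits.HodgeConjecture.CorCM.Census.OcticWeilMixedParts
import HarnessLib

/-!
# TWO `(1,3)`-types over one octic CM field `F ⊇ k` with `2`-transitive quartic part: `E × B × B'₁ × B'₂` for the `(2,2)`-type
# `Φ_{I_0}` and two `(1,3)`-types `Φ'_0`, `Φ'_2` SPLIT by `I_0` — the balanced weights of every product of copies are conjugate
# pairs, Weil `4`-sets of `B`, Weil SIXFOLD `6`-sets of `B'_c × E × E` and the EIGHTFOLD `8`-set of `B'₁ × B̄'₂` (kernel census)

COR-CM (cell `pub-hodgecm2`), seat b30 gen 21 (2026-08-22); count-neutral own lane OCTIC-WEIL-EIGHTFOLD (the case «any two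
`(1,3)`-types» left open by `Census/OcticWeilMixed`: RATIONALLY clean, but the `E`-free balanced `8`-set
`{(1,a,+)} ⊔ {(2,a,−)}` — the Weil weight of the eightfold `B'₁ × B̄'₂` — is not a disjoint union of pairs and sixfold parts; it is
made algebraic downstream by PUSH-PULL through four fresh curve slots, `CorCM/CMWeightPushforwardExtraction`).  Bookkeeping
definitions and theorems of a finite model; no named fact, no geometry, no `sorry`.  The 26-point model `Pt₃`, `cj₃`, the `A₄`
tables `permTab` / `signTab` / `sixTab` and the counting lemmas of `Census/OcticWeilOrbit`, `Census/OcticWeilMixed` are reused BY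
NAME; only the TYPE TABLE changes.

SETTING (formalised downstream, `CorCM/OcticWeil13PairFrameTransfer`).  `F ⊇ i(k)` octic CM, `τ : k → ℂ`, a frame
`e : Hom(F, ℂ) ≃ Fin 4 × Bool` (`(e s).2 = [s ∘ i = τ]`, `e s̄ = ((e s).1, ¬(e s).2)`); slot `0`: the `(2,2)`-type `Φ_{I_0}`,
`I_0 = {0, 1}`; slot `1`: the `(1,3)`-type `Φ'_0 = {e⁻¹(0, true)} ⊔ {e⁻¹(a, false) | a ≠ 0}` (its member over `τ` lies IN `I_0`);
slot `2`: the `(1,3)`-type `Φ'_2` (its member over `τ` lies OUTSIDE `I_0`).  Every pair of DISTINCT positions is brought to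
`(0, 2)` by relabeling the frame, and without a slot-`0` factor the table of slot `0` is idle; so this one table serves every
pair of `(1,3)`-types of distinct `τ`-position, and — with `B` — the split position.  THE GALOIS INPUT: every even permutation
`permTab r` of the pairs is induced by an automorphism of `ℂ` fixing `τ` (`2`-transitivity; Dodson for `B` simple).

MODEL.  `inr (m, (a, s))` = the embedding of `F` with label `(a, s)` on a factor of slot `m`; `ρ_r⁻¹(type)` on slot `m` is
`{(a, s) | s = signTabP r m a}` with `signTabP r 0 a = signTab r 0 a`, `signTabP r 1 a = [permTab r a = 0]`,
`signTabP r 2 a = [permTab r a = 2]`.  `ModelBalancedP v T`: the twelve equations `2 · #{x ∈ T | v x ∈ phiP r} = |T|`.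

RESULTS (kernel).
* `balancedP_iff_signed` — signed form `e + Σ_{m,a} ± d_{m,a} = 0` of the `r`-th equation;
* **`defectP_of_signed` / `exists_defectP_of_modelBalancedP`** — THE DEFECT LAW: `d_{m,a} = d_{m,0}` for all `m, a` AND
  `e = 2 d_{1,0} + 2 d_{2,0}` (solution space mod pairs `= ℤ W(B) ⊕ ℤ S(B'₁) ⊕ ℤ S(B'₂)`, `S(B'_c) = 2[E₊] + Σ_a [(m_c, a, +)]`;
  when `d_{1,0}` and `d_{2,0}` have opposite signs the curve defect `e` is too small for sixfold parts and the EIGHTFOLD part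
  `{(1,a,+)} ⊔ {(2,a,−)}` (`e`-free) is forced — the sequel `Census/OcticWeil13PairParts`);
NOT CLEAN (recorded, not claimed): both `(1,3)`-positions inside `I_0`, or both outside (`3` extra rational solutions each).
[cite: Pohlmann1968, Thm 1] [cite: GaoUllmo2025, Thm 3.1] [cite: Dodson1984, §3.3.2 Theorem] [cite: MoonenZarhin1995Duke, Thm. 2.4]

## References
* [Pohlmann1968] H. Pohlmann, Ann. of Math. 88 (1968), Thm 1.  [GaoUllmo2025] Z. Gao, E. Ullmo, J. Inst. Math. Jussieu 25
  (2025), Thm 3.1.  [Dodson1984] B. Dodson, Trans. AMS 283 (1984), §3.3.2.  [MoonenZarhin1995Duke] Duke Math. J. 77 (1995),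
  Thm. 2.4.  [Gordon1999HodgeAVSurvey] B. B. Gordon, CRM Monogr. 10 (1999), 5.13 (ii), 9.2.2.  [Milne2020HodgeClassesAV]
  J. S. Milne, arXiv:2010.08857, 1.2 (a), Thm. 1.

## Provenance
Exact python first (seat folder `work/scratch/census13pair.py`): nullity of the twelve signed equations in the `13` unknowns is
`3` for the split position `(0 ∈ I_0, 2 ∉ I_0)` and `6` for the non-split positions; without slot `0` it is `2` for every pair
of distinct positions.
-/

namespace Summit.HodgeConjecture.CorCM.Census.OcticWeil13Pair

open Finset
open Summit.HodgeConjecture.CorCM.Census.OcticWeilOrbit (Pt₃ cj₃ cj₃_inl cj₃_inr cj₃_facts permTab signTab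
  card_filter_mem_eq_sum₃ card_eq_sum₃ sum_pt₃)
open Summit.HodgeConjecture.CorCM.Census.OcticWeilMixed (sixTab sixTab_eq)

/-! ### The type table -/

/-- **The type table**: slot `0` the `(2,2)`-type `Φ_{I_0}` read after `ρ_r` (`signTab r 0 a = [permTab r a ∈ I_0]`), slot `1`
the `(1,3)`-type at position `0` (`sixTab 0 r a = [permTab r a = 0]`), slot `2` the `(1,3)`-type at position `2`
(`sixTab 2 r a = [permTab r a = 2]`). [cite: GaoUllmo2025, Thm 3.1 (3.2)] -/
def signTabP (r : Fin 12) (m : Fin 3) (a : Fin 4) : Bool :=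
  if m = 0 then signTab r 0 a else if m = 1 then sixTab 0 r a else sixTab 2 r a

/-- Unfolding on slot `0`. [folklore] -/
theorem signTabP_zero (r : Fin 12) (a : Fin 4) : signTabP r 0 a = signTab r 0 a := rfl

/-- Unfolding on slot `1`: `[permTab r a = 0]`. [folklore] -/
theorem signTabP_one (r : Fin 12) (a : Fin 4) : signTabP r 1 a = decide (permTab r a = 0) := by
  rw [← sixTab_eq]; rfl

/-- Unfolding on slot `2`: `[permTab r a = 2]`. [folklore] -/
theorem signTabP_two (r : Fin 12) (a : Fin 4) : signTabP r 2 a = decide (permTab r a = 2) := by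
  rw [← sixTab_eq]; rfl

/-- `ρ_r⁻¹(type)` read in the model (Boolean form). [cite: GaoUllmo2025, Thm 3.1 (3.2)] -/
def inPhiP (r : Fin 12) : Pt₃ → Bool
  | Sum.inl s => s
  | Sum.inr (m, (a, s)) => s == signTabP r m a

/-- `ρ_r⁻¹(type)` as a finset of the model. [cite: GaoUllmo2025, Thm 3.1 (3.2)] -/
def phiP (r : Fin 12) : Finset Pt₃ := univ.filter fun y => inPhiP r y = true

/-- Membership, curve slot. [folklore] -/
theorem inl_mem_phiP (r : Fin 12) (s : Bool) : Sum.inl s ∈ phiP r ↔ s = true := by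
  simp [phiP, inPhiP]

/-- Membership, fourfold slots. [folklore] -/
theorem inr_mem_phiP (r : Fin 12) (m : Fin 3) (a : Fin 4) (s : Bool) :
    Sum.inr (m, (a, s)) ∈ phiP r ↔ s = signTabP r m a := by
  simp [phiP, inPhiP]

/-- Each `phiP r` is a CM type of the model (exactly one of `y`, `cj₃ y`; thirteen points). [folklore] -/
theorem phiP_isCMType : ∀ r : Fin 12, (∀ y : Pt₃, (y ∈ phiP r ↔ cj₃ y ∉ phiP r)) ∧ (phiP r).card = 13 := by
  unfold phiP inPhiP signTabP sixTab
  decide +kernel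

/-- `phiP r` as an explicit finset: `{inl true} ⊔ {inr (m, (a, signTabP r m a))}`. [folklore] -/
theorem phiP_eq (r : Fin 12) : phiP r =
    insert (Sum.inl true) ((univ : Finset (Fin 3 × Fin 4)).image fun q => (Sum.inr (q.1, (q.2, signTabP r q.1 q.2)) : Pt₃)) := by
  revert r
  unfold phiP inPhiP
  decide +kernel

/-! ### Balanced configurations -/

variable {α : Type*}

/-- **Pohlmann's condition for a configuration** of a product of copies of `E, B, B'₁, B'₂` under `A₄`-realisation: the twelve
equations `2 · #{x ∈ T | v x ∈ ρ_r⁻¹(type)} = |T|`. [cite: GaoUllmo2025, Thm 3.1 eq. (3.2)] [cite: Dodson1984, §3.3.2 Theorem] -/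
def ModelBalancedP (v : α → Pt₃) (T : Finset α) : Prop :=
  ∀ r : Fin 12, 2 * (T.filter fun x => v x ∈ phiP r).card = T.card

variable (v : α → Pt₃)

/-- The empty configuration is balanced. [folklore] -/
theorem modelBalancedP_empty : ModelBalancedP v (∅ : Finset α) := fun _ => by simp

variable {v}

/-- **Removing a balanced part keeps the balance.** [folklore] -/
theorem ModelBalancedP.sdiff [DecidableEq α] {T G : Finset α} (hT : ModelBalancedP v T) (hG : ModelBalancedP v G)
    (hGT : G ⊆ T) : ModelBalancedP v (T \ G) := by
  intro r
  have key : ∀ (Q : α → Prop) [DecidablePred Q],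
      ((T \ G).filter Q).card = (T.filter Q).card - (G.filter Q).card := by
    intro Q _
    rw [← Finset.card_sdiff_of_subset (Finset.filter_subset_filter Q hGT)]
    congr 1
    ext x
    simp only [Finset.mem_filter, Finset.mem_sdiff]
    tauto
  have h1 := hT r
  have h2 := hG r
  have h3 := Finset.card_sdiff_of_subset hGT
  have h4 : (G.filter fun x => v x ∈ phiP r).card ≤ (T.filter fun x => v x ∈ phiP r).card :=
    Finset.card_le_card (Finset.filter_subset_filter _ hGT)
  rw [key, h3]
  omega

/-! ### The signed form -/

variable (v)

/-- The sum over `phiP r`, expanded. [folklore] -/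
theorem sum_phiP (r : Fin 12) (N : Pt₃ → ℕ) :
    ∑ y ∈ phiP r, N y = N (Sum.inl true) + ∑ m : Fin 3, ∑ a : Fin 4, N (Sum.inr (m, (a, signTabP r m a))) := by
  rw [phiP_eq r]
  have hinj : Function.Injective fun q : Fin 3 × Fin 4 => (Sum.inr (q.1, (q.2, signTabP r q.1 q.2)) : Pt₃) := by
    rintro ⟨m, a⟩ ⟨m', a'⟩ h
    simp only [Sum.inr.injEq, Prod.mk.injEq] at h
    obtain ⟨rfl, rfl, -⟩ := h
    rfl
  have h1 : Sum.inl true ∉ (univ : Finset (Fin 3 × Fin 4)).image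
      fun q => (Sum.inr (q.1, (q.2, signTabP r q.1 q.2)) : Pt₃) := by simp
  rw [Finset.sum_insert h1, Finset.sum_image fun q _ q' _ h => hinj h, Fintype.sum_prod_type]

/-- **The signed form of the `r`-th balance equation**: `2 Σ_{y ∈ phiP r} N y = Σ_y N y` iff
`(N t − N f) + Σ_{m,a} ± (N(m,a,t) − N(m,a,f)) = 0`, the sign being `+` iff `signTabP r m a`. [cite: GaoUllmo2025, Thm 3.1] -/
theorem balancedP_iff_signed (r : Fin 12) (N : Pt₃ → ℕ) :
    2 * ∑ y ∈ phiP r, N y = ∑ y : Pt₃, N y ↔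
      ((N (Sum.inl true) : ℤ) - N (Sum.inl false)) + ∑ m : Fin 3, ∑ a : Fin 4,
        (if signTabP r m a then ((N (Sum.inr (m, (a, true))) : ℤ) - N (Sum.inr (m, (a, false))))
          else -(((N (Sum.inr (m, (a, true))) : ℤ) - N (Sum.inr (m, (a, false)))))) = 0 := by
  rw [sum_phiP, sum_pt₃]
  have key : ∀ m a, (2 * (N (Sum.inr (m, (a, signTabP r m a))) : ℤ)) =
      ((N (Sum.inr (m, (a, true))) : ℤ) + N (Sum.inr (m, (a, false)))) +
        (if signTabP r m a then ((N (Sum.inr (m, (a, true))) : ℤ) - N (Sum.inr (m, (a, false))))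
          else -(((N (Sum.inr (m, (a, true))) : ℤ) - N (Sum.inr (m, (a, false)))))) := by
    intro m a
    cases signTabP r m a <;> simp <;> ring
  have hsum : (2 * (∑ m : Fin 3, ∑ a : Fin 4, N (Sum.inr (m, (a, signTabP r m a)))) : ℤ) =
      (∑ m : Fin 3, ∑ a : Fin 4, (((N (Sum.inr (m, (a, true))) : ℤ) + N (Sum.inr (m, (a, false)))))) +
        ∑ m : Fin 3, ∑ a : Fin 4,
          (if signTabP r m a then ((N (Sum.inr (m, (a, true))) : ℤ) - N (Sum.inr (m, (a, false))))
            else -(((N (Sum.inr (m, (a, true))) : ℤ) - N (Sum.inr (m, (a, false)))))) := by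
    push_cast
    rw [Finset.mul_sum, ← Finset.sum_add_distrib]
    refine Finset.sum_congr rfl fun m _ => ?_
    rw [Finset.mul_sum, ← Finset.sum_add_distrib]
    refine Finset.sum_congr rfl fun a _ => ?_
    exact key m a
  constructor
  · intro h
    have hz : (2 : ℤ) * ((N (Sum.inl true) : ℤ) + ((∑ m : Fin 3, ∑ a : Fin 4, N (Sum.inr (m, (a, signTabP r m a))) : ℕ) : ℤ)) =
        (N (Sum.inl true) : ℤ) + N (Sum.inl false) +
          ((∑ m : Fin 3, ∑ a : Fin 4, (N (Sum.inr (m, (a, true))) + N (Sum.inr (m, (a, false)))) : ℕ) : ℤ) := by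
      exact_mod_cast h
    push_cast at hz hsum
    linarith
  · intro h
    have hz : (2 : ℤ) * ((N (Sum.inl true) : ℤ) + ((∑ m : Fin 3, ∑ a : Fin 4, N (Sum.inr (m, (a, signTabP r m a))) : ℕ) : ℤ)) =
        (N (Sum.inl true) : ℤ) + N (Sum.inl false) +
          ((∑ m : Fin 3, ∑ a : Fin 4, (N (Sum.inr (m, (a, true))) + N (Sum.inr (m, (a, false)))) : ℕ) : ℤ) := by
      push_cast at hsum ⊢
      linarith
    exact_mod_cast hz

/-! ### The defect law -/

/-- The defect law, slot `0`: `d_{0,a}` is constant in `a`. [cite: Dodson1984, §3.3.2 Theorem] -/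
private theorem defectP_m0 (e : ℤ) (d : Fin 3 → Fin 4 → ℤ)
    (h : ∀ r : Fin 12, e + ∑ m : Fin 3, ∑ a : Fin 4, (if signTabP r m a then d m a else -d m a) = 0) (a : Fin 4) :
    d 0 a = d 0 0 := by
  have h0 := h 0; have h1 := h 1; have h2 := h 2; have h3 := h 3; have h4 := h 4; have h5 := h 5
  have h6 := h 6; have h7 := h 7; have h8 := h 8; have h9 := h 9; have h10 := h 10; have h11 := h 11
  simp [Fin.sum_univ_three, Fin.sum_univ_four, signTabP, signTab, sixTab] at h0 h1 h2 h3 h4 h5 h6 h7 h8 h9 h10 h11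
  fin_cases a <;> simp <;> omega

/-- The defect law, slot `1`: `d_{1,a}` is constant in `a`. [cite: Dodson1984, §3.3.2 Theorem] -/
private theorem defectP_m1 (e : ℤ) (d : Fin 3 → Fin 4 → ℤ)
    (h : ∀ r : Fin 12, e + ∑ m : Fin 3, ∑ a : Fin 4, (if signTabP r m a then d m a else -d m a) = 0) (a : Fin 4) :
    d 1 a = d 1 0 := by
  have h0 := h 0; have h1 := h 1; have h2 := h 2; have h3 := h 3; have h4 := h 4; have h5 := h 5
  have h6 := h 6; have h7 := h 7; have h8 := h 8; have h9 := h 9; have h10 := h 10; have h11 := h 11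
  simp [Fin.sum_univ_three, Fin.sum_univ_four, signTabP, signTab, sixTab] at h0 h1 h2 h3 h4 h5 h6 h7 h8 h9 h10 h11
  fin_cases a <;> simp <;> omega

/-- The defect law, slot `2`: `d_{2,a}` is constant in `a`. [cite: Dodson1984, §3.3.2 Theorem] -/
private theorem defectP_m2 (e : ℤ) (d : Fin 3 → Fin 4 → ℤ)
    (h : ∀ r : Fin 12, e + ∑ m : Fin 3, ∑ a : Fin 4, (if signTabP r m a then d m a else -d m a) = 0) (a : Fin 4) :
    d 2 a = d 2 0 := by
  have h0 := h 0; have h1 := h 1; have h2 := h 2; have h3 := h 3; have h4 := h 4; have h5 := h 5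
  have h6 := h 6; have h7 := h 7; have h8 := h 8; have h9 := h 9; have h10 := h 10; have h11 := h 11
  simp [Fin.sum_univ_three, Fin.sum_univ_four, signTabP, signTab, sixTab] at h0 h1 h2 h3 h4 h5 h6 h7 h8 h9 h10 h11
  fin_cases a <;> simp <;> omega

/-- The defect law, curve: `e = 2 d_{1,0} + 2 d_{2,0}`. [cite: Dodson1984, §3.3.2 Theorem] -/
private theorem defectP_e (e : ℤ) (d : Fin 3 → Fin 4 → ℤ)
    (h : ∀ r : Fin 12, e + ∑ m : Fin 3, ∑ a : Fin 4, (if signTabP r m a then d m a else -d m a) = 0) :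
    e = 2 * d 1 0 + 2 * d 2 0 := by
  have h0 := h 0; have h1 := h 1; have h2 := h 2; have h3 := h 3; have h4 := h 4; have h5 := h 5
  have h6 := h 6; have h7 := h 7; have h8 := h 8; have h9 := h 9; have h10 := h 10; have h11 := h 11
  simp [Fin.sum_univ_three, Fin.sum_univ_four, signTabP, signTab, sixTab] at h0 h1 h2 h3 h4 h5 h6 h7 h8 h9 h10 h11
  omega

/-- **THE DEFECT LAW, linear-algebra core**: the twelve signed `A₄`-equations force each `d_m` to be constant in `a` AND
`e = 2 d_{1,0} + 2 d_{2,0}` (solution space of dimension `3` in the `13` unknowns, exact python `census13pair.py`).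
[cite: Dodson1984, §3.3.2 Theorem] [cite: MoonenZarhin1995Duke, Thm. 2.4] -/
theorem defectP_of_signed (e : ℤ) (d : Fin 3 → Fin 4 → ℤ)
    (h : ∀ r : Fin 12, e + ∑ m : Fin 3, ∑ a : Fin 4, (if signTabP r m a then d m a else -d m a) = 0) :
    (∀ (m : Fin 3) (a : Fin 4), d m a = d m 0) ∧ e = 2 * d 1 0 + 2 * d 2 0 := by
  refine ⟨fun m => ?_, defectP_e e d h⟩
  fin_cases m
  exacts [defectP_m0 e d h, defectP_m1 e d h, defectP_m2 e d h]

variable {v}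

/-- **THE DEFECT LAW of a balanced configuration**: for each slot `m` ONE integer `t_m` with `N(m,a,true) − N(m,a,false) = t_m`
for all `a`, and on the curve `N(inl true) − N(inl false) = 2 t_1 + 2 t_2`. [cite: GaoUllmo2025, Thm 3.1] [cite: Dodson1984, §3.3.2 Theorem] -/
theorem exists_defectP_of_modelBalancedP {T : Finset α} (hT : ModelBalancedP v T) :
    ∃ t : Fin 3 → ℤ, (∀ (m : Fin 3) (a : Fin 4), ((T.filter fun x => v x = Sum.inr (m, (a, true))).card : ℤ) -
        (T.filter fun x => v x = Sum.inr (m, (a, false))).card = t m) ∧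
      ((T.filter fun x => v x = Sum.inl true).card : ℤ) - (T.filter fun x => v x = Sum.inl false).card = 2 * t 1 + 2 * t 2 := by
  have hs := fun r => (balancedP_iff_signed r (fun y => (T.filter fun x => v x = y).card)).1 (by
    have h := hT r
    rw [card_filter_mem_eq_sum₃, card_eq_sum₃ v T] at h
    exact h)
  obtain ⟨hd, he⟩ := defectP_of_signed _
    (fun m a => (((T.filter fun x => v x = Sum.inr (m, (a, true))).card : ℕ) : ℤ) -
      (T.filter fun x => v x = Sum.inr (m, (a, false))).card) hs
  exact ⟨fun m => ((T.filter fun x => v x = Sum.inr (m, ((0 : Fin 4), true))).card : ℤ) -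
      (T.filter fun x => v x = Sum.inr (m, ((0 : Fin 4), false))).card, fun m a => hd m a, he⟩

end Summit.HodgeConjecture.CorCM.Census.OcticWeil13Pair
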